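import Literature.AlgebraicTopology.SingularHomology.RelativeCupProduct
import HarnessLib

/-!
# The right action of `H*(X)` on `H*(X, A)` and the linearity of the connecting map

A. Hatcher, *Algebraic Topology* (2002), §3.2 p. 209 (the relative cup product
`Hᵖ(X, A; R) × Hᵠ(X; R) → Hᵖ⁺ᵠ(X, A; R)`: "`Cⁿ(X; R)` acts on the cochains vanishing on chains in
`A`") with Lemma 3.6 (Leibniz) and §3.3 p. 240 / §3.1 p. 200 (the connecting homomorphism on
representatives): the structure needed to make connecting homomorphisms `H*(X)`-LINEAR
(D. Husemoller, *Fibre Bundles*, Ch. 17 §1, proof of the Leray–Hirsch theorem: the comparison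
maps form "a commutative diagram with exact rows").

* `relSingularCohomology.cupRightRep h φ ψ ∈ C(X, A)` — the cochain product of a relative cochain
  with a global cochain (front face in `A`), `d_cupRightRep` (Leibniz with `dψ = 0`);
* `relSingularCohomology.cupRight h a y ∈ Hⁿ(X, A)` — **the right cup product by a global class**,
  computed on representatives (`cupRight_homologyCls`), bilinear;
* `toAbsolute_cupRight` — its image in `Hⁿ(X)` is the absolute cup product;
* `map_cupRight` — naturality under maps of pairs;
* **`δ_cupRight`** — `δ(x ⌣ i^*y) = δ(x) ⌣ y` for the connecting map `δ : H*(A) → H*⁺¹(X, A)`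
  and a global class `y ∈ H*(X)` (`i : A ⊆ X`).

Everything is proved; no named facts.

## References

* A. Hatcher, *Algebraic Topology*, CUP 2002, §3.2 p. 209, Lemma 3.6, §3.1 p. 200. [HatcherAT2002]
* D. Husemoller, *Fibre Bundles*, GTM 20, Springer 1994, Ch. 17 §1 Thm. 1.1 (proof). [HusemollerFibreBundles1994]
-/

open CategoryTheory CategoryTheory.Limits

noncomputable section

universe u v

namespace Literature.AlgebraicTopology.SingularHomology

namespace relSingularCohomology

open relCochainComplex

variable {R : Type u} [CommRing R] {X : Type u} [TopologicalSpace X] {A : Set X} {p q n : ℕ}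

/-! ### The product of a relative cochain with a global cochain -/

/-- `Cᵖ(X, A) ⌣ Cᵠ(X) ⊆ Cⁿ(X, A)` (the front face of a simplex in `A` is in `A`). [cite: HatcherAT2002, §3.2 p. 209] -/
theorem cochainCup_mem_relCochains (h : p + q = n) {φ : SingularSimplex X p → R} (hφ : φ ∈ relCochains R R A p)
    (ψ : (singularCochainComplex R R X).X q) : cochainCup h φ ψ ∈ relCochains R R A n :=
  fun σ hσ ↦ cochainCup_apply_eq_zero_of_front h φ ψ hφ σ hσ

/-- **The product `φ ⌣ ψ ∈ Cⁿ(X, A)` of a relative cochain `φ` with a global cochain `ψ`.** [cite: HatcherAT2002, §3.2 p. 209] -/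
def cupRightRep (h : p + q = n) (φ : (relCochainComplex R R A).X p) (ψ : (singularCochainComplex R R X).X q) :
    (relCochainComplex R R A).X n :=
  mk (cochainCup h (val φ) ψ) (cochainCup_mem_relCochains h (val_mem φ) ψ)

/-- The underlying cochain of the product. [folklore] -/
@[simp] theorem val_cupRightRep (h : p + q = n) (φ : (relCochainComplex R R A).X p) (ψ : (singularCochainComplex R R X).X q) :
    val (cupRightRep h φ ψ) = cochainCup h (val φ) ψ := rfl

/-- Additivity on the left. [folklore] -/
theorem cupRightRep_add_left (h : p + q = n) (φ φ' : (relCochainComplex R R A).X p) (ψ : (singularCochainComplex R R X).X q) :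
    cupRightRep h (φ + φ') ψ = cupRightRep h φ ψ + cupRightRep h φ' ψ :=
  val_injective (by simp [map_add])

/-- Additivity on the right. [folklore] -/
theorem cupRightRep_add_right (h : p + q = n) (φ : (relCochainComplex R R A).X p) (ψ ψ' : (singularCochainComplex R R X).X q) :
    cupRightRep h φ (ψ + ψ') = cupRightRep h φ ψ + cupRightRep h φ ψ' :=
  val_injective (map_add (cochainCup h (val φ)) ψ ψ')

/-- Homogeneity on the left. [folklore] -/
theorem cupRightRep_smul_left (h : p + q = n) (r : R) (φ : (relCochainComplex R R A).X p) (ψ : (singularCochainComplex R R X).X q) :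
    cupRightRep h (r • φ) ψ = r • cupRightRep h φ ψ :=
  val_injective (by simp [map_smul])

/-- Homogeneity on the right. [folklore] -/
theorem cupRightRep_smul_right (h : p + q = n) (r : R) (φ : (relCochainComplex R R A).X p) (ψ : (singularCochainComplex R R X).X q) :
    cupRightRep h φ (r • ψ) = r • cupRightRep h φ ψ :=
  val_injective (map_smul (cochainCup h (val φ)) r ψ)

/-- `0 ⌣ ψ = 0`. [folklore] -/
theorem cupRightRep_zero_left (h : p + q = n) (ψ : (singularCochainComplex R R X).X q) :
    cupRightRep h (0 : (relCochainComplex R R A).X p) ψ = 0 :=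
  val_injective (by simp)

/-- `φ ⌣ 0 = 0`. [folklore] -/
theorem cupRightRep_zero_right (h : p + q = n) (φ : (relCochainComplex R R A).X p) :
    cupRightRep h φ (0 : (singularCochainComplex R R X).X q) = 0 :=
  val_injective (map_zero (cochainCup h (val φ)))

/-- **Leibniz**: `δ(φ ⌣ ψ) = δφ ⌣ ψ + (-1)ᵖ φ ⌣ δψ` in `C(X, A)`. [cite: HatcherAT2002, Lemma 3.6] -/
theorem d_cupRightRep (h : p + q = n) (φ : (relCochainComplex R R A).X p) (ψ : (singularCochainComplex R R X).X q) :
    (relCochainComplex R R A).d n (n + 1) (cupRightRep h φ ψ) =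
      cupRightRep (show (p + 1) + q = n + 1 by omega) ((relCochainComplex R R A).d p (p + 1) φ) ψ +
        (-1 : R) ^ p • cupRightRep (show p + (q + 1) = n + 1 by omega) φ
          ((singularCochainComplex R R X).d q (q + 1) ψ) := by
  apply val_injective
  rw [val_d, val_cupRightRep, d_cochainCup, val_add, val_cupRightRep, val_d]
  rfl

/-- Leibniz with a cocycle `ψ`: `δ(φ ⌣ ψ) = δφ ⌣ ψ`. [cite: HatcherAT2002, Lemma 3.6] -/
theorem d_cupRightRep_of_d_eq_zero (h : p + q = n) (φ : (relCochainComplex R R A).X p) {ψ : (singularCochainComplex R R X).X q}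
    (hψ : (singularCochainComplex R R X).d q (q + 1) ψ = 0) :
    (relCochainComplex R R A).d n (n + 1) (cupRightRep h φ ψ) =
      cupRightRep (show (p + 1) + q = n + 1 by omega) ((relCochainComplex R R A).d p (p + 1) φ) ψ := by
  rw [d_cupRightRep, hψ, cupRightRep_zero_right, smul_zero, add_zero]

/-- The product of a relative cocycle and a cocycle is a relative cocycle. [folklore] -/
theorem d_cupRightRep_eq_zero (h : p + q = n) {φ : (relCochainComplex R R A).X p}
    (hφ : (relCochainComplex R R A).d p (p + 1) φ = 0) {ψ : (singularCochainComplex R R X).X q}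
    (hψ : (singularCochainComplex R R X).d q (q + 1) ψ = 0) :
    (relCochainComplex R R A).d n (n + 1) (cupRightRep h φ ψ) = 0 := by
  rw [d_cupRightRep_of_d_eq_zero h φ hψ, hφ, cupRightRep_zero_left]

/-- Cocycle condition: from the `k + 1` shape to the `next` shape. [folklore] -/
theorem d_next_eq_zero {K : CochainComplex (ModuleCat.{u} R) ℕ} {k : ℕ} {z : K.X k} (h : K.d k (k + 1) z = 0) :
    K.d k ((ComplexShape.up ℕ).next k) z = 0 := by
  rw [CochainComplex.next]; exact h

/-- Cocycle condition: from the `next` shape to the `k + 1` shape. [folklore] -/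
theorem d_succ_eq_zero {K : CochainComplex (ModuleCat.{u} R) ℕ} {k : ℕ} {z : K.X k} (h : K.d k ((ComplexShape.up ℕ).next k) z = 0) :
    K.d k (k + 1) z = 0 := by
  rw [CochainComplex.next] at h; exact h

/-! ### The product on classes -/

/-- A chosen cocycle representing an absolute class. [folklore] -/
def absRep (y : singularCohomology R R X q) : (singularCochainComplex R R X).X q :=
  (homologyCls_surjective (K := singularCochainComplex R R X) y).choose

/-- The chosen representative is a cocycle (`next` shape). [folklore] -/
theorem absRep_d_next (y : singularCohomology R R X q) :
    (singularCochainComplex R R X).d q ((ComplexShape.up ℕ).next q) (absRep y) = 0 :=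
  (homologyCls_surjective (K := singularCochainComplex R R X) y).choose_spec.choose

/-- The chosen representative is a cocycle. [folklore] -/
theorem absRep_d (y : singularCohomology R R X q) : (singularCochainComplex R R X).d q (q + 1) (absRep y) = 0 := by
  exact d_succ_eq_zero (absRep_d_next y)

/-- The chosen representative represents the class. [folklore] -/
theorem homologyCls_absRep (y : singularCohomology R R X q) :
    homologyCls (K := singularCochainComplex R R X) (absRep y) (absRep_d_next y) = y :=
  (homologyCls_surjective (K := singularCochainComplex R R X) y).choose_spec.choose_spec

/-- **The right cup product `Hᵖ(X, A) × Hᵠ(X) → Hⁿ(X, A)` by a global class** (`p + q = n`).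
[cite: HatcherAT2002, §3.2 p. 209] -/
def cupRight (h : p + q = n) (a : relSingularCohomology R R X A p) (y : singularCohomology R R X q) :
    relSingularCohomology R R X A n :=
  homologyCls (K := relCochainComplex R R A) (cupRightRep h (rep a) (absRep y))
    (d_next_eq_zero (d_cupRightRep_eq_zero h (rep_d a) (absRep_d y)))

/-- `d` in shape `d m n` of the product, both factors cocycles, vanishes. [folklore] -/
theorem d_cupRightRep_eq_zero' (h : p + q = n) {φ : (relCochainComplex R R A).X p}
    (hφ : (relCochainComplex R R A).d p (p + 1) φ = 0) {ψ : (singularCochainComplex R R X).X q}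
    (hψ : (singularCochainComplex R R X).d q (q + 1) ψ = 0) (m : ℕ) :
    (relCochainComplex R R A).d n m (cupRightRep h φ ψ) = 0 := by
  by_cases hm : n + 1 = m
  · subst hm; exact d_cupRightRep_eq_zero h hφ hψ
  · rw [(relCochainComplex R R A).shape n m hm]; rfl

/-- Left coboundaries give zero: `[δw ⌣ ψ] = 0` (`ψ` a cocycle). [cite: HatcherAT2002, §3.2 p. 206] -/
theorem homologyCls_cupRightRep_d_left (h : p + q = n) {i : ℕ} (w : (relCochainComplex R R A).X i)
    {ψ : (singularCochainComplex R R X).X q} (hψ : (singularCochainComplex R R X).d q (q + 1) ψ = 0)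
    (hd : (relCochainComplex R R A).d n ((ComplexShape.up ℕ).next n) (cupRightRep h ((relCochainComplex R R A).d i p w) ψ) = 0) :
    homologyCls (K := relCochainComplex R R A) (cupRightRep h ((relCochainComplex R R A).d i p w) ψ) hd = 0 := by
  by_cases hip : i + 1 = p
  · subst hip
    obtain rfl : n = i + q + 1 := by omega
    have e : cupRightRep h ((relCochainComplex R R A).d i (i + 1) w) ψ =
        (relCochainComplex R R A).d (i + q) (i + q + 1) (cupRightRep rfl w ψ) :=
      (d_cupRightRep_of_d_eq_zero rfl w hψ).symm
    rw [homologyCls_congr e hd (by rw [← e]; exact hd)]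
    exact homologyCls_d_eq_zero _ _
  · have e : cupRightRep h ((relCochainComplex R R A).d i p w) ψ = 0 := by
      rw [(relCochainComplex R R A).shape i p hip]
      exact cupRightRep_zero_left h ψ
    rw [homologyCls_congr e hd (by rw [map_zero])]
    exact homologyCls_zero _

/-- Right coboundaries give zero: `[φ ⌣ δv] = 0` (`φ` a relative cocycle). [cite: HatcherAT2002, §3.2 p. 206] -/
theorem homologyCls_cupRightRep_d_right (h : p + q = n) {i : ℕ} (v : (singularCochainComplex R R X).X i)
    {φ : (relCochainComplex R R A).X p} (hφ : (relCochainComplex R R A).d p (p + 1) φ = 0)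
    (hd : (relCochainComplex R R A).d n ((ComplexShape.up ℕ).next n)
      (cupRightRep h φ ((singularCochainComplex R R X).d i q v)) = 0) :
    homologyCls (K := relCochainComplex R R A) (cupRightRep h φ ((singularCochainComplex R R X).d i q v)) hd = 0 := by
  by_cases hiq : i + 1 = q
  · subst hiq
    obtain rfl : n = p + i + 1 := by omega
    have e : cupRightRep h φ ((singularCochainComplex R R X).d i (i + 1) v) =
        ((-1 : R) ^ p) • (relCochainComplex R R A).d (p + i) (p + i + 1) (cupRightRep rfl φ v) := by
      rw [d_cupRightRep (rfl : p + i = p + i) φ v, hφ, cupRightRep_zero_left, zero_add, smul_smul, ← pow_add,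
        ← two_mul, pow_mul, neg_one_sq, one_pow, one_smul]
    have hd' : (relCochainComplex R R A).d (p + i + 1) ((ComplexShape.up ℕ).next (p + i + 1))
        ((relCochainComplex R R A).d (p + i) (p + i + 1) (cupRightRep rfl φ v)) = 0 := by
      rw [← ModuleCat.comp_apply, HomologicalComplex.d_comp_d]; rfl
    rw [homologyCls_congr e hd (by rw [map_smul, hd', smul_zero]), homologyCls_smul _ _ hd',
      homologyCls_d_eq_zero _ _, smul_zero]
  · have e : cupRightRep h φ ((singularCochainComplex R R X).d i q v) = 0 := by
      rw [(singularCochainComplex R R X).shape i q hiq]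
      exact cupRightRep_zero_right h φ
    rw [homologyCls_congr e hd (by rw [map_zero])]
    exact homologyCls_zero _

/-- **Well-definedness / computation on representatives**: `[φ] ⌣ [ψ] = [φ ⌣ ψ]`. [cite: HatcherAT2002, §3.2 p. 209] -/
theorem cupRight_homologyCls (h : p + q = n) (φ : (relCochainComplex R R A).X p)
    (hφ : (relCochainComplex R R A).d p ((ComplexShape.up ℕ).next p) φ = 0)
    (ψ : (singularCochainComplex R R X).X q) (hψ : (singularCochainComplex R R X).d q ((ComplexShape.up ℕ).next q) ψ = 0)
    (hc : (relCochainComplex R R A).d n ((ComplexShape.up ℕ).next n) (cupRightRep h φ ψ) = 0) :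
    cupRight h (homologyCls φ hφ) (homologyCls ψ hψ) = homologyCls (cupRightRep h φ ψ) hc := by
  have hφ1 : (relCochainComplex R R A).d p (p + 1) φ = 0 := d_succ_eq_zero (hφ)
  have hψ1 : (singularCochainComplex R R X).d q (q + 1) ψ = 0 := d_succ_eq_zero (hψ)
  set a := homologyCls (K := relCochainComplex R R A) φ hφ with ha
  set y := homologyCls (K := singularCochainComplex R R X) ψ hψ with hy
  -- the chosen representatives differ from `φ`, `ψ` by coboundaries
  have h1 : homologyCls (K := relCochainComplex R R A) (rep a) (rep_d_next a) = homologyCls φ hφ := by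
    rw [homologyCls_rep]
  obtain ⟨w, hw⟩ := (homologyCls_eq_homologyCls_iff (K := relCochainComplex R R A) _ _ _ _).1 h1
  have h2 : homologyCls (K := singularCochainComplex R R X) (absRep y) (absRep_d_next y) = homologyCls ψ hψ := by
    rw [homologyCls_absRep]
  obtain ⟨v, hv⟩ := (homologyCls_eq_homologyCls_iff (K := singularCochainComplex R R X) _ _ _ _).1 h2
  have hrep : rep a = φ + (relCochainComplex R R A).d _ p w := by rw [hw, add_sub_cancel]
  have habs : absRep y = ψ + (singularCochainComplex R R X).d _ q v := by rw [hv, add_sub_cancel]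
  -- expand by bilinearity
  have e : cupRightRep h (rep a) (absRep y) =
      cupRightRep h φ ψ + (cupRightRep h ((relCochainComplex R R A).d _ p w) (absRep y) +
        cupRightRep h φ ((singularCochainComplex R R X).d _ q v)) := by
    conv_lhs => rw [hrep, cupRightRep_add_left]
    conv_lhs => arg 1; rw [habs, cupRightRep_add_right]
    abel
  have hd1 : (relCochainComplex R R A).d n ((ComplexShape.up ℕ).next n)
      (cupRightRep h ((relCochainComplex R R A).d _ p w) (absRep y)) = 0 := by
    apply d_cupRightRep_eq_zero' h _ (absRep_d y)
    rw [← ModuleCat.comp_apply, HomologicalComplex.d_comp_d]; rfl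
  have hd2 : (relCochainComplex R R A).d n ((ComplexShape.up ℕ).next n)
      (cupRightRep h φ ((singularCochainComplex R R X).d _ q v)) = 0 := by
    apply d_cupRightRep_eq_zero' h hφ1
    rw [← ModuleCat.comp_apply, HomologicalComplex.d_comp_d]; rfl
  have hd12 : (relCochainComplex R R A).d n ((ComplexShape.up ℕ).next n)
      (cupRightRep h ((relCochainComplex R R A).d _ p w) (absRep y) +
        cupRightRep h φ ((singularCochainComplex R R X).d _ q v)) = 0 := by
    rw [map_add, hd1, hd2, add_zero]
  change homologyCls (K := relCochainComplex R R A) (cupRightRep h (rep a) (absRep y)) _ = _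
  rw [homologyCls_congr e _ (by rw [map_add, hc, hd12, add_zero]), homologyCls_add _ _ hc hd12,
    homologyCls_add _ _ hd1 hd2, homologyCls_cupRightRep_d_left h w (absRep_d y) hd1,
    homologyCls_cupRightRep_d_right h v hφ1 hd2, add_zero, add_zero]

/-- `cupRight` is additive on the left. [folklore] -/
theorem cupRight_add_left (h : p + q = n) (a a' : relSingularCohomology R R X A p) (y : singularCohomology R R X q) :
    cupRight h (a + a') y = cupRight h a y + cupRight h a' y := by
  obtain ⟨φ, hφ, rfl⟩ := homologyCls_surjective (K := relCochainComplex R R A) a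
  obtain ⟨φ', hφ', rfl⟩ := homologyCls_surjective (K := relCochainComplex R R A) a'
  obtain ⟨ψ, hψ, rfl⟩ := homologyCls_surjective (K := singularCochainComplex R R X) y
  have hψ1 : (singularCochainComplex R R X).d q (q + 1) ψ = 0 := d_succ_eq_zero (hψ)
  have hφ1 : (relCochainComplex R R A).d p (p + 1) φ = 0 := d_succ_eq_zero (hφ)
  have hφ1' : (relCochainComplex R R A).d p (p + 1) φ' = 0 := d_succ_eq_zero (hφ')
  have hsum : (relCochainComplex R R A).d p ((ComplexShape.up ℕ).next p) (φ + φ') = 0 := by rw [map_add, hφ, hφ', add_zero]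
  have e1 : homologyCls (K := relCochainComplex R R A) φ hφ + homologyCls (K := relCochainComplex R R A) φ' hφ' =
      homologyCls (K := relCochainComplex R R A) (φ + φ') hsum :=
    (homologyCls_add _ _ hφ hφ' hsum).symm
  refine (congrArg (fun t ↦ cupRight h t (homologyCls (K := singularCochainComplex R R X) ψ hψ)) e1).trans ?_
  rw [cupRight_homologyCls h _ hsum ψ hψ (d_next_eq_zero (d_cupRightRep_eq_zero h (by rw [map_add, hφ1, hφ1', add_zero]) hψ1)),
    cupRight_homologyCls h φ hφ ψ hψ (d_next_eq_zero (d_cupRightRep_eq_zero h hφ1 hψ1)),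
    cupRight_homologyCls h φ' hφ' ψ hψ (d_next_eq_zero (d_cupRightRep_eq_zero h hφ1' hψ1))]
  have hdsum : (relCochainComplex R R A).d n ((ComplexShape.up ℕ).next n) (cupRightRep h φ ψ + cupRightRep h φ' ψ) = 0 := by
    rw [map_add, d_next_eq_zero (d_cupRightRep_eq_zero h hφ1 hψ1), d_next_eq_zero (d_cupRightRep_eq_zero h hφ1' hψ1), add_zero]
  rw [homologyCls_congr (cupRightRep_add_left h φ φ' ψ) _ hdsum,
    homologyCls_add _ _ (d_next_eq_zero (d_cupRightRep_eq_zero h hφ1 hψ1)) (d_next_eq_zero (d_cupRightRep_eq_zero h hφ1' hψ1)) hdsum]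
  rfl

/-- `cupRight` is additive on the right. [folklore] -/
theorem cupRight_add_right (h : p + q = n) (a : relSingularCohomology R R X A p) (y y' : singularCohomology R R X q) :
    cupRight h a (y + y') = cupRight h a y + cupRight h a y' := by
  obtain ⟨φ, hφ, rfl⟩ := homologyCls_surjective (K := relCochainComplex R R A) a
  obtain ⟨ψ, hψ, rfl⟩ := homologyCls_surjective (K := singularCochainComplex R R X) y
  obtain ⟨ψ', hψ', rfl⟩ := homologyCls_surjective (K := singularCochainComplex R R X) y'
  have hψ1 : (singularCochainComplex R R X).d q (q + 1) ψ = 0 := d_succ_eq_zero (hψ)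
  have hψ1' : (singularCochainComplex R R X).d q (q + 1) ψ' = 0 := d_succ_eq_zero (hψ')
  have hφ1 : (relCochainComplex R R A).d p (p + 1) φ = 0 := d_succ_eq_zero (hφ)
  have hsum : (singularCochainComplex R R X).d q ((ComplexShape.up ℕ).next q) (ψ + ψ') = 0 := by rw [map_add, hψ, hψ', add_zero]
  have e1 : homologyCls (K := singularCochainComplex R R X) ψ hψ + homologyCls (K := singularCochainComplex R R X) ψ' hψ' =
      homologyCls (K := singularCochainComplex R R X) (ψ + ψ') hsum :=
    (homologyCls_add _ _ hψ hψ' hsum).symm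
  refine (congrArg (fun t ↦ cupRight h (homologyCls (K := relCochainComplex R R A) φ hφ) t) e1).trans ?_
  rw [cupRight_homologyCls h φ hφ _ hsum (d_next_eq_zero (d_cupRightRep_eq_zero h hφ1 (by rw [map_add, hψ1, hψ1', add_zero]))),
    cupRight_homologyCls h φ hφ ψ hψ (d_next_eq_zero (d_cupRightRep_eq_zero h hφ1 hψ1)),
    cupRight_homologyCls h φ hφ ψ' hψ' (d_next_eq_zero (d_cupRightRep_eq_zero h hφ1 hψ1'))]
  have hdsum : (relCochainComplex R R A).d n ((ComplexShape.up ℕ).next n) (cupRightRep h φ ψ + cupRightRep h φ ψ') = 0 := by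
    rw [map_add, d_next_eq_zero (d_cupRightRep_eq_zero h hφ1 hψ1), d_next_eq_zero (d_cupRightRep_eq_zero h hφ1 hψ1'), add_zero]
  rw [homologyCls_congr (cupRightRep_add_right h φ ψ ψ') _ hdsum,
    homologyCls_add _ _ (d_next_eq_zero (d_cupRightRep_eq_zero h hφ1 hψ1)) (d_next_eq_zero (d_cupRightRep_eq_zero h hφ1 hψ1')) hdsum]
  rfl

/-- `cupRight` is homogeneous on the left. [folklore] -/
theorem cupRight_smul_left (h : p + q = n) (r : R) (a : relSingularCohomology R R X A p) (y : singularCohomology R R X q) :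
    cupRight h (r • a) y = r • cupRight h a y := by
  obtain ⟨φ, hφ, rfl⟩ := homologyCls_surjective (K := relCochainComplex R R A) a
  obtain ⟨ψ, hψ, rfl⟩ := homologyCls_surjective (K := singularCochainComplex R R X) y
  have hψ1 : (singularCochainComplex R R X).d q (q + 1) ψ = 0 := d_succ_eq_zero (hψ)
  have hφ1 : (relCochainComplex R R A).d p (p + 1) φ = 0 := d_succ_eq_zero (hφ)
  have hsm : (relCochainComplex R R A).d p ((ComplexShape.up ℕ).next p) (r • φ) = 0 := by rw [map_smul, hφ, smul_zero]
  have e1 : r • homologyCls (K := relCochainComplex R R A) φ hφ = homologyCls (K := relCochainComplex R R A) (r • φ) hsm :=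
    (homologyCls_smul r φ hφ hsm).symm
  refine (congrArg (fun t ↦ cupRight h t (homologyCls (K := singularCochainComplex R R X) ψ hψ)) e1).trans ?_
  rw [cupRight_homologyCls h _ hsm ψ hψ (d_next_eq_zero (d_cupRightRep_eq_zero h (by rw [map_smul, hφ1, smul_zero]) hψ1)),
    cupRight_homologyCls h φ hφ ψ hψ (d_next_eq_zero (d_cupRightRep_eq_zero h hφ1 hψ1))]
  have hdsm : (relCochainComplex R R A).d n ((ComplexShape.up ℕ).next n) (r • cupRightRep h φ ψ) = 0 := by
    rw [map_smul, d_next_eq_zero (d_cupRightRep_eq_zero h hφ1 hψ1), smul_zero]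
  rw [homologyCls_congr (cupRightRep_smul_left h r φ ψ) _ hdsm,
    homologyCls_smul _ _ (d_next_eq_zero (d_cupRightRep_eq_zero h hφ1 hψ1)) hdsm]
  rfl

/-! ### Compatibilities -/

/-- **In `Hⁿ(X)` the right product is the cup product**: `toAbsolute (a ⌣ y) = toAbsolute a ⌣ y`.
[cite: HatcherAT2002, §3.2 p. 209] -/
theorem toAbsolute_cupRight (h : p + q = n) (a : relSingularCohomology R R X A p) (y : singularCohomology R R X q) :
    toAbsolute R R X A n (cupRight h a y) = cupProduct h (toAbsolute R R X A p a) y := by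
  obtain ⟨φ, hφ, rfl⟩ := homologyCls_surjective (K := relCochainComplex R R A) a
  obtain ⟨ψ, hψ, rfl⟩ := homologyCls_surjective (K := singularCochainComplex R R X) y
  have hψ1 : (singularCochainComplex R R X).d q (q + 1) ψ = 0 := d_succ_eq_zero (hψ)
  have hφ1 : (relCochainComplex R R A).d p (p + 1) φ = 0 := d_succ_eq_zero (hφ)
  rw [cupRight_homologyCls h φ hφ ψ hψ (d_next_eq_zero (d_cupRightRep_eq_zero h hφ1 hψ1))]
  change HomologicalComplex.homologyMap (relCochainComplex.ι R R A) n _ =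
    cupProduct h (HomologicalComplex.homologyMap (relCochainComplex.ι R R A) p _) _
  rw [homologyMap_ι_homologyCls _ _ (d_val_eq_zero (d_cupRightRep_eq_zero h hφ1 hψ1)),
    homologyMap_ι_homologyCls _ _ (d_val_eq_zero hφ1),
    ← π_cocyclesMk_eq_homologyCls ψ hψ1 hψ]
  change _ = cupProduct h (singularCohomology.π R R X p _) (singularCohomology.π R R X q _)
  rw [cupProduct_π_π]
  change (singularCochainComplex R R X).homologyπ n _ = (singularCochainComplex R R X).homologyπ n _
  congr 1
  exact singularCochainComplex.cocycles_ext (by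
    rw [singularCochainComplex.iCocycles_cocyclesCup, singularCochainComplex.iCocycles_mk,
      singularCochainComplex.iCocycles_mk, singularCochainComplex.iCocycles_mk]; rfl)

/-- **Naturality** under a map of pairs `f : (X', A') → (X, A)`: `f^*(a ⌣ y) = f^*a ⌣ f^*y`.
[cite: HatcherAT2002, Prop. 3.10] -/
theorem map_cupRight {X' : Type u} [TopologicalSpace X'] {A' : Set X'} (f : C(X', X)) (hf : Set.MapsTo f A' A)
    (h : p + q = n) (a : relSingularCohomology R R X A p) (y : singularCohomology R R X q) :
    relSingularCohomology.map R R f hf n (cupRight h a y) =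
      cupRight h (relSingularCohomology.map R R f hf p a) (singularCohomology.map R R f q y) := by
  obtain ⟨φ, hφ, rfl⟩ := homologyCls_surjective (K := relCochainComplex R R A) a
  obtain ⟨ψ, hψ, rfl⟩ := homologyCls_surjective (K := singularCochainComplex R R X) y
  have hψ1 : (singularCochainComplex R R X).d q (q + 1) ψ = 0 := d_succ_eq_zero (hψ)
  have hφ1 : (relCochainComplex R R A).d p (p + 1) φ = 0 := d_succ_eq_zero (hφ)
  rw [cupRight_homologyCls h φ hφ ψ hψ (d_next_eq_zero (d_cupRightRep_eq_zero h hφ1 hψ1))]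
  change HomologicalComplex.homologyMap (relCochainComplex.map R R f hf) n _ =
    cupRight h (HomologicalComplex.homologyMap (relCochainComplex.map R R f hf) p _)
      (HomologicalComplex.homologyMap (singularCochainComplex.map R R f) q _)
  rw [homologyMap_homologyCls, homologyMap_homologyCls, homologyMap_homologyCls, cupRight_homologyCls]
  · exact homologyCls_congr (val_injective (by
      rw [val_map_f, val_cupRightRep, val_cupRightRep, val_map_f, cochainCup_map])) _ _
  · exact d_next_eq_zero (d_cupRightRep_eq_zero h (d_succ_eq_zero (d_hom_f_eq_zero (relCochainComplex.map R R f hf) φ hφ))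
      (d_succ_eq_zero (d_hom_f_eq_zero (singularCochainComplex.map R R f) ψ hψ)))

/-- The cup product on cocycle representatives: `[φ] ⌣ [ψ] = [φ ⌣ ψ]`. [cite: HatcherAT2002, §3.2 p. 206] -/
theorem cupProduct_homologyCls {Y : Type u} [TopologicalSpace Y] (h : p + q = n) (φ : (singularCochainComplex R R Y).X p)
    (hφ : (singularCochainComplex R R Y).d p ((ComplexShape.up ℕ).next p) φ = 0) (ψ : (singularCochainComplex R R Y).X q)
    (hψ : (singularCochainComplex R R Y).d q ((ComplexShape.up ℕ).next q) ψ = 0)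
    (hc : (singularCochainComplex R R Y).d n ((ComplexShape.up ℕ).next n) (cochainCup h φ ψ) = 0) :
    cupProduct h (homologyCls (K := singularCochainComplex R R Y) φ hφ) (homologyCls (K := singularCochainComplex R R Y) ψ hψ) =
      homologyCls (K := singularCochainComplex R R Y) (cochainCup h φ ψ) hc := by
  have hφ1 : (singularCochainComplex R R Y).d p (p + 1) φ = 0 := d_succ_eq_zero (hφ)
  have hψ1 : (singularCochainComplex R R Y).d q (q + 1) ψ = 0 := d_succ_eq_zero (hψ)
  have hc1 : (singularCochainComplex R R Y).d n (n + 1) (cochainCup h φ ψ) = 0 := d_succ_eq_zero (hc)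
  rw [← π_cocyclesMk_eq_homologyCls φ hφ1 hφ, ← π_cocyclesMk_eq_homologyCls ψ hψ1 hψ,
    ← π_cocyclesMk_eq_homologyCls _ hc1 hc]
  change cupProduct h (singularCohomology.π R R Y p _) (singularCohomology.π R R Y q _) = singularCohomology.π R R Y n _
  rw [cupProduct_π_π]
  congr 1
  exact singularCochainComplex.cocycles_ext (by
    rw [singularCochainComplex.iCocycles_cocyclesCup, singularCochainComplex.iCocycles_mk,
      singularCochainComplex.iCocycles_mk, singularCochainComplex.iCocycles_mk])

/-- **Linearity of the connecting map**: for `x ∈ Hⁱ(A)` and a global class `y ∈ Hᵠ(X)`,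
`δ(x ⌣ i^*y) = δ(x) ⌣ y` in `H^{i+q+1}(X, A)` (Husemoller Ch. 17 §1: the connecting maps of the
comparison diagram commute with the module structure). [cite: HusemollerFibreBundles1994, Ch. 17 §1 Thm. 1.1 (proof)] -/
theorem δ_cupRight {i : ℕ} (hiq : i + q = n) (x : singularCohomology R R (↥A) i) (y : singularCohomology R R X q) :
    δ R R X A n (n + 1) rfl (cupProduct hiq x (singularCohomology.map R R (subsetIncl A) q y)) =
      cupRight (show (i + 1) + q = n + 1 by omega) (δ R R X A i (i + 1) rfl x) y := by
  obtain ⟨α, hα, rfl⟩ := homologyCls_surjective (K := singularCochainComplex R R ↥A) x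
  obtain ⟨ψ, hψ, rfl⟩ := homologyCls_surjective (K := singularCochainComplex R R X) y
  have hψ1 : (singularCochainComplex R R X).d q (q + 1) ψ = 0 := d_succ_eq_zero (hψ)
  have hα1 : (singularCochainComplex R R ↥A).d i (i + 1) α = 0 := d_succ_eq_zero (hα)
  -- a lift `β` of `α`; then `β ⌣ ψ` lifts `α ⌣ ψ|`
  obtain ⟨β, hβ⟩ := relCochainComplex.ρ_f_surjective (R := R) (M := R) (A := A) (n := i) α
  have hdβ : ((singularCochainComplex R R X).d i (i + 1) β : SingularSimplex X (i + 1) → R) ∈ relCochains R R A (i + 1) := by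
    apply relCochainComplex.mem_relCochains_of_ρ_eq_zero
    rw [← ModuleCat.comp_apply, ← (relCochainComplex.ρ R R A).comm, ModuleCat.comp_apply, hβ, hα1]
  have hδ := δ_homologyCls (R := R) (M := R) rfl α hα β hβ hdβ (d_mk_d_eq_zero β hdβ _)
  have hρψ : (singularCochainComplex R R ↥A).d q (q + 1) ((relCochainComplex.ρ R R A).f q ψ) = 0 := by
    rw [← ModuleCat.comp_apply, (relCochainComplex.ρ R R A).comm, ModuleCat.comp_apply, hψ1, map_zero]
  have hprodc : (singularCochainComplex R R ↥A).d n ((ComplexShape.up ℕ).next n)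
      (cochainCup hiq α ((relCochainComplex.ρ R R A).f q ψ)) = 0 := by
    subst hiq
    apply d_next_eq_zero
    rw [d_cochainCup, hα1, hρψ]
    erw [map_zero, LinearMap.zero_apply, map_zero, smul_zero, add_zero]
    rfl
  have hprod : cupProduct hiq (homologyCls (K := singularCochainComplex R R ↥A) α hα)
      (singularCohomology.map R R (subsetIncl A) q (homologyCls (K := singularCochainComplex R R X) ψ hψ)) =
        homologyCls (K := singularCochainComplex R R ↥A) (cochainCup hiq α ((relCochainComplex.ρ R R A).f q ψ)) hprodc := by
    change cupProduct hiq _ (HomologicalComplex.homologyMap (singularCochainComplex.map R R (subsetIncl A)) q _) = _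
    rw [homologyMap_homologyCls, cupProduct_homologyCls]
  rw [hprod]
  -- the lift `β ⌣ ψ` and its coboundary `dβ ⌣ ψ`
  have hlift : (relCochainComplex.ρ R R A).f n (cochainCup hiq β ψ) = cochainCup hiq α ((relCochainComplex.ρ R R A).f q ψ) := by
    change (singularCochainComplex.map R R (subsetIncl A)).f n (cochainCup hiq β ψ) = _
    rw [cochainCup_map]
    exact congrArg (fun t ↦ cochainCup hiq t _) hβ
  have hdlift_eq : ((singularCochainComplex R R X).d n (n + 1) (cochainCup hiq β ψ) : SingularSimplex X (n + 1) → R) =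
      cochainCup (show (i + 1) + q = n + 1 by omega) ((singularCochainComplex R R X).d i (i + 1) β) ψ := by
    subst hiq
    rw [d_cochainCup, hψ1]
    erw [map_zero, smul_zero, add_zero]
  have hdlift : ((singularCochainComplex R R X).d n (n + 1) (cochainCup hiq β ψ) : SingularSimplex X (n + 1) → R) ∈
      relCochains R R A (n + 1) := by
    rw [hdlift_eq]
    exact cochainCup_mem_relCochains _ hdβ ψ
  rw [δ_homologyCls (R := R) (M := R) rfl _ hprodc (cochainCup hiq β ψ) hlift hdlift (d_mk_d_eq_zero _ hdlift _), hδ,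
    cupRight_homologyCls]
  · exact homologyCls_congr (val_injective (by rw [val_mk, val_cupRightRep, val_mk, hdlift_eq])) _ _
  · exact d_next_eq_zero (d_cupRightRep_eq_zero _ (d_mk_d_eq_zero β hdβ _) hψ1)

end relSingularCohomology

end Literature.AlgebraicTopology.SingularHomology
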